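import Mathlib
import Summits.KontsevichZagierPeriods.Zeta5Search.DenomLaw.RecordZeroCellsPlus
import Summits.KontsevichZagierPeriods.Zeta5Search.ZeroWindowM8
import Summits.KontsevichZagierPeriods.Zeta5Search.ZeroWindowM8Layer
import Summits.KontsevichZagierPeriods.Zeta5Search.ZeroWindowM10
import Summits.KontsevichZagierPeriods.Zeta5Search.ZeroWindowM14
import Summits.KontsevichZagierPeriods.Zeta5Search.ZeroWindowM14Layer

/-!
# ζ(5) search — DENOM-LAW D1: the record zero cells `N⁺`, `L⁺`, `H⁺` ARE THEOREMS (by name, from the landed type-space windows)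

Cell `pub-zeta5`, track DENOM-LAW (D1), denom-prover-d1 g5.  HONEST FRAMING: systematic search; `p`-adic valuations of the explicit
rationals `Cas₇(b(n))` on the Brown–Zudilin record ray; nothing about ζ(5); no γ moves; no irrationality claim; records in print UNMOVED.

Discharges BY NAME the three `@[conjecture]` targets of `DenomLaw/RecordZeroCellsPlus.lean` (denom-prover-d1 g4, p368424; the «dual-side
Φ-staircase» of `denom-law/prover-d1/ATTEMPT-5.md` §4 / `denom-law/DUAL-PHI-LAW.md`, whose mechanism theory-d1 g9 identified as the residue
theorem, `denom-law/theory-d1g9/MU-LAW-PROOF.md`).  That mechanism is gen-2 g11's RESIDUE IDENTITY / TYPE-SPACE LAW (`Zeta5Search/ResidueLaw.lean`,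
REPORT-gen2-g11 §2–§5), already THEOREMS in the tree (`residueIdentity_holds`, `residueIdentityB_holds`, `typeSpaceLawZero_holds`), and the
three record windows were closed by census g21 / the `ZeroWindow*` seats: `recWindowM8_holds`, `recWindowM8Layer_holds` (cell N, `M = 8`),
`recWindowM10_holds` (cell L, `M = 10`), `recWindowM14_holds`, `recWindowM14Layer_holds` (cell H, `M = 14`).  The present file is the arithmetic
glue only: `RecordCellNPlus = RecWindowM8 ∪ RecWindowM8Layer` (split `5p ≥ 41n + 3` / `5p − 41n ∈ {1,2}`; `3p = 25n` is impossible for a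
prime `p > 8n`), `RecordCellLPlus = RecWindowM10` (`4p = 25n` impossible), `RecordCellHPlus = RecWindowM14 ∪ RecWindowM14Layer`.
-/

namespace Summit.KontsevichZagierPeriods.Zeta5Search.RecordAtlas

open Summit.KontsevichZagierPeriods.Zeta5Search.ResidueLaw (RecWindowM8 RecWindowM8Layer RecWindowM10 RecWindowM14 RecWindowM14Layer)

/-- On the record ray a prime `p ≥ 7` never satisfies `k·p = 25n` with `k ∈ {3, 4, 6}`: it would force `5 ∣ p`. -/
theorem five_dvd_of_mul_eq {k p n : ℕ} (hp : p.Prime) (hk : Nat.Coprime 5 k) (h : k * p = 25 * n) : p = 5 := by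
  have h5 : 5 ∣ k * p := ⟨5 * n, by rw [h]; ring⟩
  have h5p : 5 ∣ p := hk.dvd_of_dvd_mul_left h5
  exact ((Nat.Prime.eq_one_or_self_of_dvd hp 5 h5p).resolve_left (by norm_num)).symm

/-- **RECORD CELL N⁺ IS A THEOREM** (`41n < 5p`, `3p ≤ 25n` ⇒ `v_p(Cas₇(b(n))) ≥ −10`): the zero type-space window `M = 8`
(`ZeroWindowM8.recWindowM8_holds`) and its boundary layer (`ZeroWindowM8Layer.recWindowM8Layer_holds`). -/
theorem recordCellNPlus_holds : RecordCellNPlus := by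
  intro n p hn hp h41 h3 hne
  by_cases hlayer : 5 * p ≤ 41 * n + 2
  · exact ZeroWindowM8Layer.recWindowM8Layer_holds n p hn hp h41 hlayer hne
  · have hlt : 3 * p < 25 * n := by
      rcases Nat.lt_or_eq_of_le h3 with h | h
      · exact h
      · exfalso
        have := five_dvd_of_mul_eq hp (by norm_num) h
        omega
    exact ZeroWindowM8.recWindowM8_holds n p hn hp (by omega) hlt hne

/-- **RECORD CELL L⁺ IS A THEOREM** (`6n < p`, `4p ≤ 25n` ⇒ `v_p(Cas₇(b(n))) ≥ −14`): the zero type-space window `M = 10`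
(`ZeroWindowM10.recWindowM10_holds`). -/
theorem recordCellLPlus_holds : RecordCellLPlus := by
  intro n p hn hp h6 h4 hne
  have hlt : 4 * p < 25 * n := by
    rcases Nat.lt_or_eq_of_le h4 with h | h
    · exact h
    · exfalso
      have := five_dvd_of_mul_eq hp (by norm_num) h
      omega
  exact ZeroWindowM10.recWindowM10_holds n p hn hp h6 hlt hne

/-- **RECORD CELL H⁺ IS A THEOREM** (`41n < 10p`, `6p ≤ 25n` ⇒ `v_p(Cas₇(b(n))) ≥ −22`): the zero type-space window `M = 14`
(`ZeroWindowM14.recWindowM14_holds`) and its boundary layer (`ZeroWindowM14Layer.recWindowM14Layer_holds`). -/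
theorem recordCellHPlus_holds : RecordCellHPlus := by
  intro n p hn hp h41 h6 hne
  by_cases hlayer : 10 * p ≤ 41 * n + 2
  · exact ZeroWindowM14Layer.recWindowM14Layer_holds n p hn hp h41 hlayer hne
  · have hlt : 6 * p < 25 * n := by
      rcases Nat.lt_or_eq_of_le h6 with h | h
      · exact h
      · exfalso
        have := five_dvd_of_mul_eq hp (by norm_num) h
        omega
    exact ZeroWindowM14.recWindowM14_holds n p hn hp (by omega) hlt hne

end Summit.KontsevichZagierPeriods.Zeta5Search.RecordAtlas
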